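import Mathlib
import Literature.Analysis.FluidPDE.BeltramiFlows
import Literature.Analysis.FluidPDE.ClassicalSolution
import Summits.NavierStokesRegularity.NavierStokesRegularity.Theorems.QuarterLogPincerSilencingCostDefs
import Summits.NavierStokesRegularity.NavierStokesRegularity.Theorems.TypeIQuantSubcubicExp.Negative.SilencingCostBurnout
import HarnessLib

/-!
# Line `silencing_cost`, stubs Sc `EnstrophyPersistence` and Sb `VorticalCentre`: the `∇²u` bound, the slice energy
# and the order `∀ C₀ ∃ Γ₂` are load-bearing (kernel facts) — refuter lane ns-afl-r1

Supports crux stmt-NavierStokesRegularity-24077 (`QuarterLogPincer.TypeIQuantSubcubicExp`) via ns-idea-7's line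
`Cruxes/TypeIQuantSubcubicExp/Lines/silencing_cost.lean` (v1.2, sha16 7454702080d03f79); the stubs are in the tree BY NAME
as `SilencingCost.EnstrophyPersistence`, `SilencingCost.VorticalCentre`, `SilencingCost.BoxBound`
(`…Theorems.QuarterLogPincerSilencingCostDefs`, pub-ns-dss typer g38).  NO Theses decl is asserted; nothing about the
crux or about Sb, Sc AS STATED is proved or refuted (HONEST FRAME: 24077, W7 and Navier–Stokes regularity are OPEN).
Witnesses: the tree's strong-Beltrami Navier–Stokes solutions `e^{−t}·abc 0 b 0` (`ABC.isClassicalNSSolutionOn_abc`)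
and the constant stream; shared lemmas from `…Negative.SilencingCostBurnout`.  The one-line implications
`enstrophyPersistence_of_C1`, `vorticalCentre_of_noEnergy`, `vorticalCentre_of_gammaFirst` into the NAMED stubs certify
that each mutation is the stub with exactly one hypothesis (or one quantifier order) changed, everything else verbatim.

* `enstrophyPersistence_false_without_hessianBound` — Sc with the `C²` box bound weakened to a `C¹` box bound
  (`j ≤ 1`) is FALSE for GENUINE Navier–Stokes solutions: `u = e^{−s}·abc 0 σ⁻² 0` on `[0,σ²]` (`M₁ = 2`,
  `δ = Γ₂ = 1`, burn-out scale `σ² = 5K³/c + 1`).  Any proof of Sc — in particular the card's soft route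
  (compactness + backward uniqueness), whose equi-Lipschitz step is where `∇²u` enters — must use the `∇²u` bound.
* `vorticalCentre_false_without_energy` — Sb without the slice-energy hypothesis is FALSE (constant stream `v ≡ e₀`:
  hot centre, no vorticity; the card's own remark, as a kernel fact); `vorticalCentre_false_with_gamma_first` — Sb
  with `Γ₂` chosen BEFORE the energy constant `C₀` is FALSE (same stream, `C₀ = (4π/3)Γ₂²`): `Γ₂` must depend on `C₀`.
-/

-- the summit and its single sub-problem share the name (CONVENTIONS §1), as in every Theorems file
set_option linter.dupNamespace false

namespace Summit.NavierStokesRegularity.NavierStokesRegularity.Theorems.TypeIQuantSubcubicExp.Negative.SilencingCost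

noncomputable section

open MeasureTheory Set Function Filter Topology Metric Real
open scoped ENNReal NNReal Laplacian
open Literature.Analysis Literature.Analysis.FluidPDE
open Summit.NavierStokesRegularity.NavierStokesRegularity.Cruxes.TypeIQuantSubcubicExp.SilencingCost
  (BoxBound VorticalCentre EnstrophyPersistence)

/-! ## One-hypothesis mutations of Sc and Sb (the stubs themselves BY NAME from the typer's Defs port) -/

/-- The `C¹` box bound: the line's `SilencingCost.BoxBound` with `j ≤ 2` weakened to `j ≤ 1` (no bound on `∇²u`). -/
def BoxBoundC1 (M₁ σ : ℝ) (u : ℝ → (EuclideanSpace ℝ (Fin 3)) → (EuclideanSpace ℝ (Fin 3)))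
    (y : (EuclideanSpace ℝ (Fin 3))) (S : Set ℝ) (ρ : ℝ) : Prop :=
  ∀ s ∈ S, ∀ x ∈ ball y ρ, ∀ j : ℕ, j ≤ 1 →
    ‖iteratedFDeriv ℝ j (u s) x‖ ≤ M₁ * σ ^ (-((j : ℝ) + 1))

/-- The line's `C²` box bound implies the `C¹` box bound. -/
theorem boxBoundC1_of_boxBound {M₁ σ : ℝ} {u : ℝ → (EuclideanSpace ℝ (Fin 3)) → (EuclideanSpace ℝ (Fin 3))}
    {y : (EuclideanSpace ℝ (Fin 3))} {S : Set ℝ} {ρ : ℝ} (h : BoxBound M₁ σ u y S ρ) :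
    BoxBoundC1 M₁ σ u y S ρ :=
  fun s hs x hx j hj => h s hs x hx j (hj.trans one_le_two)

/-- Sc at `(M₁, δ, Γ₂)` with the `C²` box bound weakened to the `C¹` box bound (everything else verbatim). -/
def EnstrophyPersistenceC1At (M₁ δ Γ₂ : ℝ) : Prop :=
  ∃ K c : ℝ, Γ₂ ≤ K ∧ 0 < c ∧
    ∀ (T : ℝ) (u : ℝ → (EuclideanSpace ℝ (Fin 3)) → (EuclideanSpace ℝ (Fin 3)))
      (p : ℝ → (EuclideanSpace ℝ (Fin 3)) → ℝ),
      IsClassicalNSSolutionOn (Icc 0 T) 1 0 u p →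
      ∀ (y : (EuclideanSpace ℝ (Fin 3))) (σ t t₁ : ℝ), 0 < σ → 0 ≤ t → t ≤ t₁ → t₁ ≤ T → t₁ ≤ t + σ ^ 2 →
        BoxBoundC1 M₁ σ u y (Icc t t₁) (2 * K * σ) →
        ENNReal.ofReal (δ / σ) ≤ ∫⁻ x in ball y (Γ₂ * σ), ‖curl (u t) x‖ₑ ^ 2 →
        ENNReal.ofReal (c / σ) ≤ ∫⁻ x in ball y (K * σ), ‖curl (u t₁) x‖ₑ ^ 2

/-- The `C¹` variant trivially implies Sc `SilencingCost.EnstrophyPersistence` BY NAME. -/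
theorem enstrophyPersistence_of_C1
    (h : ∀ M₁ δ Γ₂ : ℝ, 1 ≤ M₁ → 0 < δ → 1 ≤ Γ₂ → EnstrophyPersistenceC1At M₁ δ Γ₂) :
    EnstrophyPersistence := by
  intro M₁ δ Γ₂ hM hδ hΓ
  obtain ⟨K, c, hK, hc, H⟩ := h M₁ δ Γ₂ hM hδ hΓ
  exact ⟨K, c, hK, hc, fun T u p hNS y σ t t₁ hσ ht htt ht₁ hspan hbox =>
    H T u p hNS y σ t t₁ hσ ht htt ht₁ hspan (boxBoundC1_of_boxBound hbox)⟩

/-- Sb at `(ε, M₁)` with the SLICE-ENERGY hypothesis deleted (the now idle parameter `C₀` is dropped as well;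
everything else verbatim). -/
def VorticalCentreNoEnergyAt (ε M₁ : ℝ) : Prop :=
  ∃ Γ₂ δ : ℝ, 1 ≤ Γ₂ ∧ 0 < δ ∧
    ∀ (v : (EuclideanSpace ℝ (Fin 3)) → (EuclideanSpace ℝ (Fin 3))) (y : (EuclideanSpace ℝ (Fin 3))) (σ : ℝ),
      0 < σ → ContDiff ℝ 2 v → VectorCalculus.IsDivFree v →
      (∀ x ∈ ball y σ, ∀ j : ℕ, j ≤ 2 → ‖iteratedFDeriv ℝ j v x‖ ≤ M₁ * σ ^ (-((j : ℝ) + 1))) →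
      ε < σ * ‖v y‖ →
      ENNReal.ofReal (δ / σ) ≤ ∫⁻ x in ball y (Γ₂ * σ), ‖curl v x‖ₑ ^ 2

/-- Sb at `(ε, M₁)` with the radius `Γ₂` chosen BEFORE the energy constant `C₀` (`∃ Γ₂ ∀ C₀ ∃ δ` instead of
`∀ C₀ ∃ Γ₂ δ`; everything else verbatim). -/
def VorticalCentreGammaFirstAt (ε M₁ : ℝ) : Prop :=
  ∃ Γ₂ : ℝ, 1 ≤ Γ₂ ∧ ∀ C₀ : ℝ, ∃ δ : ℝ, 0 < δ ∧
    ∀ (v : (EuclideanSpace ℝ (Fin 3)) → (EuclideanSpace ℝ (Fin 3))) (y : (EuclideanSpace ℝ (Fin 3))) (σ : ℝ),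
      0 < σ → ContDiff ℝ 2 v → VectorCalculus.IsDivFree v →
      (∀ x ∈ ball y σ, ∀ j : ℕ, j ≤ 2 → ‖iteratedFDeriv ℝ j v x‖ ≤ M₁ * σ ^ (-((j : ℝ) + 1))) →
      (∫⁻ x in ball y (Γ₂ * σ), ENNReal.ofReal (‖v x‖ ^ 2) ≤ ENNReal.ofReal (C₀ * (Γ₂ * σ))) →
      ε < σ * ‖v y‖ →
      ENNReal.ofReal (δ / σ) ≤ ∫⁻ x in ball y (Γ₂ * σ), ‖curl v x‖ₑ ^ 2

/-- The energy-free variant trivially implies Sb `SilencingCost.VorticalCentre` BY NAME. -/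
theorem vorticalCentre_of_noEnergy (h : ∀ ε M₁ : ℝ, 0 < ε → 1 ≤ M₁ → VorticalCentreNoEnergyAt ε M₁) :
    VorticalCentre := by
  intro ε M₁ C₀ hε hM
  obtain ⟨Γ₂, δ, hΓ, hδ, H⟩ := h ε M₁ hε hM
  exact ⟨Γ₂, δ, hΓ, hδ, fun v y σ hσ hv hdiv hbox _ hhot => H v y σ hσ hv hdiv hbox hhot⟩

/-- The `Γ₂`-first variant trivially implies Sb BY NAME. -/
theorem vorticalCentre_of_gammaFirst (h : ∀ ε M₁ : ℝ, 0 < ε → 1 ≤ M₁ → VorticalCentreGammaFirstAt ε M₁) :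
    VorticalCentre := by
  intro ε M₁ C₀ hε hM
  obtain ⟨Γ₂, hΓ, H⟩ := h ε M₁ hε hM
  obtain ⟨δ, hδ, H'⟩ := H C₀
  exact ⟨Γ₂, δ, hΓ, hδ, H'⟩

/-! ## Sc: the `∇²u` bound is load-bearing (for genuine Navier–Stokes solutions) -/

/-- **Sc needs the `∇²u` bound.**  With only the `C¹` box bound `|u| ≤ M₁σ⁻¹`, `|∇u| ≤ M₁σ⁻²`, enstrophy
persistence fails for the EXACT Navier–Stokes solutions `u(s,x) = e^{−s}·abc 0 σ⁻² 0 (x)` (strong Beltrami,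
`curl u = u`, pressure `−|u|²/2`) on `[0,σ²]`: at `M₁ = 2`, `δ = Γ₂ = 1` and the burn-out scale `σ² = 5K³/c + 1`
the centre enstrophy `(4π/3)/σ` decays to `(4π/3)K³e^{−2σ²}/σ < c/σ` while the `C¹` bounds hold on all of `ℝ³`
(`|u| ≤ σ⁻² ≤ 2σ⁻¹`, `|∇u| ≤ 2σ⁻²`).  The missing `∇²u` bound (`= σ⁻²·|∇a|` at frequency `1`, i.e. `σ⁻²` instead
of `M₁σ⁻³`) is what this family violates. [folklore] -/
theorem not_enstrophyPersistenceC1At_two : ¬ EnstrophyPersistenceC1At 2 1 1 := by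
  intro h
  obtain ⟨K, c, hK, hc, H⟩ := h
  obtain ⟨σ, hσ1, hini, hfin⟩ := exists_burnout_scale hK hc
  have hσ0 : 0 < σ := lt_of_lt_of_le one_pos hσ1
  have hK0 : 0 < K := lt_of_lt_of_le one_pos hK
  have hσ2 : (0 : ℝ) < σ ^ 2 := by positivity
  set b : ℝ := σ ^ (-(2 : ℝ)) with hb_def
  have hb0 : 0 < b := Real.rpow_pos_of_pos hσ0 _
  have hbσ : b = (σ ^ 2)⁻¹ := by rw [hb_def, Real.rpow_neg hσ0.le, Real.rpow_two]
  have hb1 : b ≤ σ⁻¹ := by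
    rw [hbσ, inv_le_inv₀ hσ2 hσ0]
    nlinarith
  set a : EuclideanSpace ℝ (Fin 3) → EuclideanSpace ℝ (Fin 3) := ABC.abc 0 1 0 with ha_def
  set v : EuclideanSpace ℝ (Fin 3) → EuclideanSpace ℝ (Fin 3) := ABC.abc 0 b 0 with hv_def
  set u : ℝ → EuclideanSpace ℝ (Fin 3) → EuclideanSpace ℝ (Fin 3) := strongBeltramiVelocity 1 1 v with hu_def
  set p : ℝ → EuclideanSpace ℝ (Fin 3) → ℝ := strongBeltramiPressure 1 1 v with hp_def
  have hNS : IsClassicalNSSolutionOn (Icc 0 (σ ^ 2)) 1 0 u p :=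
    (ABC.isClassicalNSSolutionOn_abc 0 b 0 1).mono (subset_univ _) (uniqueDiffOn_Icc hσ2)
  have hu : ∀ s, u s = fun x => (b * Real.exp (-s)) • a x := by
    intro s
    funext x
    rw [hu_def, strongBeltramiVelocity_apply, hv_def, abc_shear_eq_smul, smul_smul, ha_def]
    congr 1
    rw [mul_comm]
    norm_num
  have hnorm : ∀ s x, ‖u s x‖ = b * Real.exp (-s) := by
    intro s x
    rw [hu]
    dsimp only
    rw [norm_smul, ha_def, norm_abc_shear, mul_one, Real.norm_eq_abs,
      abs_of_pos (mul_pos hb0 (Real.exp_pos _))]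
  have hcurl : ∀ s x, curl (u s) x = u s x := by
    intro s x
    rw [hu]
    dsimp only
    rw [curl_const_smul ((ABC.differentiable_abc 0 1 0) x), ha_def, ABC.curl_abc]
  have hdecay : ∀ s, 0 ≤ s → b * Real.exp (-s) ≤ b := by
    intro s hs
    have : Real.exp (-s) ≤ 1 := Real.exp_le_one_iff.2 (by linarith)
    nlinarith
  have key := H (σ ^ 2) u p hNS 0 σ 0 (σ ^ 2) hσ0 le_rfl hσ2.le le_rfl (by simp) ?_ ?_
  · rw [lintegral_ball_of_norm_const (curl (u (σ ^ 2))) _ (mul_pos hb0 (Real.exp_pos _)).le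
      (fun x => by rw [hcurl, hnorm]) 0 (K * σ) (by positivity)] at key
    exact absurd key (not_le.2 ((ENNReal.ofReal_lt_ofReal_iff (by positivity)).2 hfin))
  · -- the `C¹` box bound at `M₁ = 2` (on all of `ℝ³`)
    intro s hs x _ j hj
    rcases Nat.le_one_iff_eq_zero_or_eq_one.1 hj with rfl | rfl
    · rw [norm_iteratedFDeriv_zero, hnorm, Nat.cast_zero, zero_add, Real.rpow_neg_one]
      linarith [hdecay s hs.1]
    · rw [norm_iteratedFDeriv_one, hu s, Nat.cast_one, show (-((1 : ℝ) + 1)) = -(2 : ℝ) by norm_num]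
      have hL := norm_fderiv_le_of_lipschitz (𝕜 := ℝ) (x₀ := x)
        (lipschitzWith_smul_abc_shear (κ := b * Real.exp (-s)) (mul_pos hb0 (Real.exp_pos _)).le)
      rw [Real.coe_toNNReal _ (by positivity)] at hL
      linarith [hdecay s hs.1]
  · rw [lintegral_ball_of_norm_const (curl (u 0)) b hb0.le
      (fun x => by rw [hcurl, hnorm, neg_zero, Real.exp_zero, mul_one]) 0 (1 * σ) (by positivity)]
    exact ENNReal.ofReal_le_ofReal hini

/-- **Sc needs the `∇²u` bound** (the mutated stub, negated). -/
theorem enstrophyPersistence_false_without_hessianBound :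
    ¬ ∀ M₁ δ Γ₂ : ℝ, 1 ≤ M₁ → 0 < δ → 1 ≤ Γ₂ → EnstrophyPersistenceC1At M₁ δ Γ₂ :=
  fun h => not_enstrophyPersistenceC1At_two (h 2 1 1 (by norm_num) one_pos le_rfl)

/-! ## Sb: the energy hypothesis and the order `∀ C₀ ∃ Γ₂` are load-bearing -/

/-- **Sb needs the slice energy.**  Without `∫_{B(y,Γ₂σ)}|v|² ≤ C₀Γ₂σ` the constant stream `v ≡ e₀` (`σ = 1`,
`ε = 1/2`, `M₁ = 1`: `C²`-bounded, divergence free, hot centre `|v(y)| = 1 > ε`) has no vorticity at all — the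
card's remark «a constant stream is excluded by the energy hypothesis» as a kernel fact. [folklore] -/
theorem not_vorticalCentreNoEnergyAt_half : ¬ VorticalCentreNoEnergyAt (1 / 2) 1 := by
  intro h
  obtain ⟨Γ₂, δ, hΓ, hδ, H⟩ := h
  set e₀ : EuclideanSpace ℝ (Fin 3) := EuclideanSpace.single 0 1 with he_def
  have he : ‖e₀‖ = 1 := by rw [he_def]; simp
  set v : EuclideanSpace ℝ (Fin 3) → EuclideanSpace ℝ (Fin 3) := fun _ => e₀ with hv_def
  have hfd : ∀ x, fderiv ℝ v x = 0 := fun x => by rw [hv_def]; simp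
  have hcurl : ∀ x, curl v x = 0 := fun x => curl_eq_zero_of_fderiv_eq_zero (hfd x)
  have key := H v 0 1 one_pos contDiff_const (fun x => by simp [VectorCalculus.divergence, hfd x]) ?_
    (by rw [hv_def]; dsimp only; rw [he]; norm_num)
  · have : ∫⁻ x in ball (0 : EuclideanSpace ℝ (Fin 3)) (Γ₂ * 1), ‖curl v x‖ₑ ^ 2 = 0 := by
      simp [hcurl]
    rw [this, div_one] at key
    exact absurd key (not_le.2 (ENNReal.ofReal_pos.2 hδ))
  · intro x _ j hj
    rw [Real.one_rpow, mul_one]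
    rcases Nat.eq_zero_or_pos j with rfl | hj0
    · rw [norm_iteratedFDeriv_zero, hv_def]
      dsimp only
      rw [he]
    · rw [hv_def, iteratedFDeriv_const_of_ne hj0.ne', Pi.zero_apply, norm_zero]
      exact zero_le_one

/-- **Sb needs the slice energy** (the mutated stub, negated). -/
theorem vorticalCentre_false_without_energy :
    ¬ ∀ ε M₁ : ℝ, 0 < ε → 1 ≤ M₁ → VorticalCentreNoEnergyAt ε M₁ :=
  fun h => not_vorticalCentreNoEnergyAt_half (h (1 / 2) 1 (by norm_num) le_rfl)

/-- **Sb's `Γ₂` must depend on the energy constant.**  If `Γ₂` is chosen before `C₀`, the constant stream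
`v ≡ e₀` on `B(0,Γ₂)` (`σ = 1`) has energy `(4π/3)Γ₂³ = C₀Γ₂` for `C₀ = (4π/3)Γ₂²`, a hot centre and no
vorticity. [folklore] -/
theorem not_vorticalCentreGammaFirstAt_half : ¬ VorticalCentreGammaFirstAt (1 / 2) 1 := by
  intro h
  obtain ⟨Γ₂, hΓ, H⟩ := h
  have hΓ0 : 0 < Γ₂ := lt_of_lt_of_le one_pos hΓ
  obtain ⟨δ, hδ, H⟩ := H (π * 4 / 3 * Γ₂ ^ 2)
  set e₀ : EuclideanSpace ℝ (Fin 3) := EuclideanSpace.single 0 1 with he_def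
  have he : ‖e₀‖ = 1 := by rw [he_def]; simp
  set v : EuclideanSpace ℝ (Fin 3) → EuclideanSpace ℝ (Fin 3) := fun _ => e₀ with hv_def
  have hfd : ∀ x, fderiv ℝ v x = 0 := fun x => by rw [hv_def]; simp
  have hcurl : ∀ x, curl v x = 0 := fun x => curl_eq_zero_of_fderiv_eq_zero (hfd x)
  have key := H v 0 1 one_pos contDiff_const (fun x => by simp [VectorCalculus.divergence, hfd x]) ?_ ?_
    (by rw [hv_def]; dsimp only; rw [he]; norm_num)
  · have : ∫⁻ x in ball (0 : EuclideanSpace ℝ (Fin 3)) (Γ₂ * 1), ‖curl v x‖ₑ ^ 2 = 0 := by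
      simp [hcurl]
    rw [this, div_one] at key
    exact absurd key (not_le.2 (ENNReal.ofReal_pos.2 hδ))
  · intro x _ j hj
    rw [Real.one_rpow, mul_one]
    rcases Nat.eq_zero_or_pos j with rfl | hj0
    · rw [norm_iteratedFDeriv_zero, hv_def]
      dsimp only
      rw [he]
    · rw [hv_def, iteratedFDeriv_const_of_ne hj0.ne', Pi.zero_apply, norm_zero]
      exact zero_le_one
  · -- energy of the unit stream on `B(0,Γ₂)`: `(4π/3)Γ₂³ = C₀ Γ₂`
    have hpt : ∀ x, ENNReal.ofReal (‖v x‖ ^ 2) = 1 := by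
      intro x; rw [hv_def]; dsimp only; rw [he]; simp
    rw [lintegral_congr hpt, setLIntegral_const, one_mul, mul_one, EuclideanSpace.volume_ball_fin_three,
      ← ENNReal.ofReal_pow hΓ0.le, ← ENNReal.ofReal_mul (by positivity)]
    refine ENNReal.ofReal_le_ofReal (le_of_eq ?_)
    ring

/-- **Sb's `Γ₂` must depend on `C₀`** (the mutated stub, negated). -/
theorem vorticalCentre_false_with_gamma_first :
    ¬ ∀ ε M₁ : ℝ, 0 < ε → 1 ≤ M₁ → VorticalCentreGammaFirstAt ε M₁ :=
  fun h => not_vorticalCentreGammaFirstAt_half (h (1 / 2) 1 (by norm_num) le_rfl)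

end

end Summit.NavierStokesRegularity.NavierStokesRegularity.Theorems.TypeIQuantSubcubicExp.Negative.SilencingCost
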